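import Summits.NavierStokesRegularity.FluidComputer.PalasekTowerPerturbedRunTools
import Literature.Analysis.FluidPDE.ClassicalSupStabilityMildBootstrap
import Literature.Analysis.FluidPDE.BoundedMildSpatialDecay
import Literature.Analysis.FluidPDE.ClassicalSolutionRescale
import Literature.Claims.NS.ClayVariants

/-!
# THE SUPERPOSED RUN, I: tools — the superposition `v₁ + v₂(· − c)` of two free classical runs solves
# the Oseen integral equation up to the cross Duhamel term, which is uniformly small for `‖c‖` large;
# mild identity, cross-term bound, sup bound of the superposition

Cell `ns-blowup`, seat `ns-blowup-ecbridge-3` (g7; D-0074 GROUP C «BRIDGE SUPPORT», lineage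
`host_preparation`; bears_on LADDER-NS N1, route `PalasekTowerBreakdown`, crux `EpisodeBase` = item
stmt-NavierStokesRegularity-19179, line `slot` v5). LABEL: E–C typing + kernel analysis (theorems only;
no definition, no named fact, no `sorry`). WHAT THIS IS NOT: not Navier–Stokes evidence — continuous
dependence / superposition bookkeeping for GIVEN classical solutions on a fixed slab; nothing about any
host, episode, `RungG 1` or blow-up.

## Contents (`ν = 1`, slab `[0, T] × ℝ³`)

* §1 `norm_oseenDuhamel_le_of_split` — the Duhamel term `B(a, b)` of two bounded slab fields of which
  `a` is `η_a`-small on a set `S` and `b` is `η_b`-small off `S` is `≤ C₀ (η_a M_b + M_a η_b) 2√t`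
  everywhere (bilinearity + the same-point transfer `K(1_{Sᶜ} a, b) = K(a, 1_{Sᶜ} b)`).
* §2 `translate` — space translates of free classical runs are free classical runs (the tree's
  `IsClassicalNSSolutionOn.spaceTranslate`), with the same energy and bounds.
* §3 `superposed_oseenMild` — for free classical bounded finite-energy runs `v₁, v₂`, the field
  `ṽ(t, x) = v₁(t, x) + v₂(t, x − c)` satisfies `ṽ(t) = e^{tΔ}ṽ(0) − B(ṽ, ṽ)(t) + Φ_c(t)` a.e. with
  `Φ_c = B(ṽ, ṽ) − B(v₁, v₁) − B(v₂c, v₂c)`; `superposedRemainder_eq` — `Φ_c = B(v₁, v₂c) + B(v₂c, v₁)`;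
  `norm_superposedRemainder_le` — if `v₁`, `v₂` are `η₁`-, `η₂`-small off the ball `B(0, ρ)` and
  `‖c‖ ≥ 2ρ`, then `‖Φ_c‖ ≤ 2 C₀ (η₁ M₂ + M₁ η₂) 2√T`; `norm_superposed_le` — `‖ṽ‖ ≤ max (M₁ + η₂) (η₁ + M₂)`.
* (§4, file `PalasekTowerSuperposedRunNear.lean`) `freeRun_near_superposed` / `freeRun_unique_superposed`
  — every classical finite-energy FREE run from the superposed datum stays within the mild-level
  bootstrap bound of `ṽ` and two such runs agree on their common slab.

Part II (`PalasekTowerSuperposedRun.lean`) assembles the maximal free run from the superposed datum on the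
whole slab; part III is the superposition door of the germ host. References: J. Leray, Acta Math. 63
(1934) §19 [cite: Leray1934, §19 (3.4)–(3.8)]; G. Koch, N. Nadirashvili, G. Seregin, V. Šverák, Acta
Math. 203 (2009) §4 [cite: KochNadirashviliSereginSverak2009, §4 p. 8 (arXiv:0709.3599v1)]; T. Tao, Anal.
PDE 6 (2013) Thm. 5.4 [cite: Tao2011, Thm. 5.4 (ii)+(iv)]; S. Palasek, arXiv:2605.13827 §4
[cite: Palasek2026ElementaryModel, §4].
-/

noncomputable section

namespace Summit.NavierStokesRegularity.FluidComputer.PalasekTowerClayBridge.SuperposedRun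

open Set MeasureTheory Filter Topology Function Real
open scoped ENNReal NNReal ContDiff
open Literature.Analysis Literature.Analysis.FluidPDE

/-! ## §1 The Duhamel term of a split pair -/

section Split

/-- **The Duhamel term of a split pair of bounded fields.** Let `a, b` be fields on the slab
`(0, T) × ℝ³`, a.e.-strongly measurable there and bounded by `M_a, M_b`, and let `S ⊆ ℝ³` be measurable
with `‖a(τ, y)‖ ≤ η_a` for `y ∈ S` and `‖b(τ, y)‖ ≤ η_b` for `y ∉ S`. Then for `0 < t ≤ T` and all `x`,
`‖B¹_0(a, b)(t)(x)‖ ≤ C₀ (η_a M_b + M_a η_b) · 2√t`: split `a = 1_S a + 1_{Sᶜ} a` (bilinearity on the slab),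
bound `B(1_S a, b)` by the slice estimate, and transfer the indicator in `B(1_{Sᶜ} a, b) = B(a, 1_{Sᶜ} b)`
pointwise under the integral (the Oseen kernel is bilinear at each point).
[cite: KochNadirashviliSereginSverak2009, §4 p. 8 (arXiv:0709.3599v1)] -/
theorem norm_oseenDuhamel_le_of_split
    {a b : ℝ → EuclideanSpace ℝ (Fin 3) → EuclideanSpace ℝ (Fin 3)} {T Ma Mb ηa ηb : ℝ}
    {S : Set (EuclideanSpace ℝ (Fin 3))} (hS : MeasurableSet S)
    (ha : AEStronglyMeasurable (uncurry a)
      ((volume : Measure (ℝ × EuclideanSpace ℝ (Fin 3))).restrict (Ioo 0 T ×ˢ univ)))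
    (hb : AEStronglyMeasurable (uncurry b)
      ((volume : Measure (ℝ × EuclideanSpace ℝ (Fin 3))).restrict (Ioo 0 T ×ˢ univ)))
    (haM : ∀ τ ∈ Ioo 0 T, ∀ y, ‖a τ y‖ ≤ Ma) (hbM : ∀ τ ∈ Ioo 0 T, ∀ y, ‖b τ y‖ ≤ Mb)
    (hηa : 0 ≤ ηa) (hηb : 0 ≤ ηb)
    (haS : ∀ τ ∈ Ioo 0 T, ∀ y ∈ S, ‖a τ y‖ ≤ ηa) (hbS : ∀ τ ∈ Ioo 0 T, ∀ y ∉ S, ‖b τ y‖ ≤ ηb)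
    {t : ℝ} (ht0 : 0 < t) (htT : t ≤ T) (x : EuclideanSpace ℝ (Fin 3)) :
    ‖oseenDuhamel 1 0 a b t x‖ ≤
      oseenSliceConst (EuclideanSpace ℝ (Fin 3)) * (ηa * Mb + Ma * ηb) * (2 * Real.sqrt t) := by
  classical
  have hν : (0 : ℝ) < 1 := one_pos
  have hMa : 0 ≤ Ma := (norm_nonneg _).trans (haM (t / 2) ⟨by linarith, by linarith⟩ 0)
  have hMb : 0 ≤ Mb := (norm_nonneg _).trans (hbM (t / 2) ⟨by linarith, by linarith⟩ 0)
  -- the split fields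
  set aS : ℝ → EuclideanSpace ℝ (Fin 3) → EuclideanSpace ℝ (Fin 3) :=
    fun τ y => if y ∈ S then a τ y else 0 with haS_def
  set bSc : ℝ → EuclideanSpace ℝ (Fin 3) → EuclideanSpace ℝ (Fin 3) :=
    fun τ y => if y ∈ S then 0 else b τ y with hbSc_def
  have hSm : MeasurableSet {p : ℝ × EuclideanSpace ℝ (Fin 3) | p.2 ∈ S} := measurable_snd hS
  have haS_eq : uncurry aS = {p : ℝ × EuclideanSpace ℝ (Fin 3) | p.2 ∈ S}.indicator (uncurry a) := by
    funext p
    rcases p with ⟨τ, y⟩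
    by_cases hy : y ∈ S
    · simp [haS_def, uncurry, hy]
    · simp [haS_def, uncurry, hy]
  have haSm : AEStronglyMeasurable (uncurry aS)
      ((volume : Measure (ℝ × EuclideanSpace ℝ (Fin 3))).restrict (Ioo 0 T ×ˢ univ)) := by
    rw [haS_eq]; exact ha.indicator hSm
  have haSM : ∀ τ ∈ Ioo 0 T, ∀ y, ‖aS τ y‖ ≤ Ma := by
    intro τ hτ y
    by_cases hy : y ∈ S
    · simp only [haS_def, hy, if_true]; exact haM τ hτ y
    · simp only [haS_def, hy, if_false, norm_zero]; exact hMa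
  have haSη : ∀ τ ∈ Ioo 0 t, ∀ y, ‖aS τ y‖ ≤ ηa := by
    intro τ hτ y
    by_cases hy : y ∈ S
    · simp only [haS_def, hy, if_true]; exact haS τ ⟨hτ.1, hτ.2.trans_le htT⟩ y hy
    · simp only [haS_def, hy, if_false, norm_zero]; exact hηa
  have hbScη : ∀ τ ∈ Ioo 0 t, ∀ y, ‖bSc τ y‖ ≤ ηb := by
    intro τ hτ y
    by_cases hy : y ∈ S
    · simp only [hbSc_def, hy, if_true, norm_zero]; exact hηb
    · simp only [hbSc_def, hy, if_false]; exact hbS τ ⟨hτ.1, hτ.2.trans_le htT⟩ y hy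
  -- bilinearity: `B(a, b) − B(aS, b) = B(a − aS, b)`
  have hsub := oseenDuhamel_sub_left hν ha haSm hb haM haSM hbM ht0 htT x
  -- the same-point transfer: `B(a − aS, b) = B(a, bSc)`
  have htransfer : oseenDuhamel 1 0 (fun τ y => a τ y - aS τ y) b t x = oseenDuhamel 1 0 a bSc t x := by
    rw [oseenDuhamel_apply, oseenDuhamel_apply]
    refine setIntegral_congr_fun measurableSet_Ioo fun τ _ => ?_
    refine integral_congr_ae (Eventually.of_forall fun y => ?_)
    by_cases hy : y ∈ S
    · simp only [haS_def, hbSc_def, hy, if_true, sub_self, oseenKernel_zero_left, oseenKernel_zero_right]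
    · simp only [haS_def, hbSc_def, hy, if_false, sub_zero]
  -- the two slice bounds
  have h1 : ‖oseenDuhamel 1 0 aS b t x‖ ≤
      oseenSliceConst (EuclideanSpace ℝ (Fin 3)) * (ηa * Mb) * (2 * Real.sqrt (t - 0)) :=
    norm_oseenDuhamel_le_const ht0.le haSη (fun τ hτ => hbM τ ⟨hτ.1, hτ.2.trans_le htT⟩) x
  have h2 : ‖oseenDuhamel 1 0 a bSc t x‖ ≤
      oseenSliceConst (EuclideanSpace ℝ (Fin 3)) * (Ma * ηb) * (2 * Real.sqrt (t - 0)) :=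
    norm_oseenDuhamel_le_const ht0.le (fun τ hτ => haM τ ⟨hτ.1, hτ.2.trans_le htT⟩) hbScη x
  rw [sub_zero] at h1 h2
  have heq : oseenDuhamel 1 0 a b t x = oseenDuhamel 1 0 aS b t x + oseenDuhamel 1 0 a bSc t x := by
    rw [← htransfer, hsub]; abel
  rw [heq]
  calc ‖oseenDuhamel 1 0 aS b t x + oseenDuhamel 1 0 a bSc t x‖
      ≤ ‖oseenDuhamel 1 0 aS b t x‖ + ‖oseenDuhamel 1 0 a bSc t x‖ := norm_add_le _ _
    _ ≤ oseenSliceConst (EuclideanSpace ℝ (Fin 3)) * (ηa * Mb) * (2 * Real.sqrt t) +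
        oseenSliceConst (EuclideanSpace ℝ (Fin 3)) * (Ma * ηb) * (2 * Real.sqrt t) := add_le_add h1 h2
    _ = _ := by ring

end Split

/-! ## §2 Space translates of free classical runs -/

section Translate

variable {S : Set ℝ} {v : ℝ → EuclideanSpace ℝ (Fin 3) → EuclideanSpace ℝ (Fin 3)}
  {q : ℝ → EuclideanSpace ℝ (Fin 3) → ℝ}

/-- A space translate of a free classical run is a free classical run (constant coefficients; the
tree's `IsClassicalNSSolutionOn.spaceTranslate`). [folklore] -/
theorem translate (h : IsClassicalNSSolutionOn S 1 0 v q) (c : EuclideanSpace ℝ (Fin 3)) :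
    IsClassicalNSSolutionOn S 1 0 (fun t x => v t (x - c)) (fun t x => q t (x - c)) := by
  have key := h.spaceTranslate (-c)
  simp only [neg_add_eq_sub] at key
  exact key

/-- The energy of a translate. [folklore] -/
theorem lintegral_translate (w : EuclideanSpace ℝ (Fin 3) → EuclideanSpace ℝ (Fin 3))
    (c : EuclideanSpace ℝ (Fin 3)) :
    ∫⁻ x, ‖w (x - c)‖ₑ ^ 2 = ∫⁻ x, ‖w x‖ₑ ^ 2 :=
  lintegral_sub_right_eq_self (fun x => ‖w x‖ₑ ^ 2) c

/-- Finite energy of the translate of a run. [folklore] -/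
theorem energy_translate {a b : ℝ}
    (hE : ∃ C : ℝ≥0∞, C < ⊤ ∧ ∀ t ∈ Icc a b, ∫⁻ x, ‖v t x‖ₑ ^ 2 ≤ C) (c : EuclideanSpace ℝ (Fin 3)) :
    ∃ C : ℝ≥0∞, C < ⊤ ∧ ∀ t ∈ Icc a b, ∫⁻ x, ‖v t (x - c)‖ₑ ^ 2 ≤ C := by
  obtain ⟨C, hC, hb⟩ := hE
  exact ⟨C, hC, fun t ht => by rw [lintegral_translate (v t) c]; exact hb t ht⟩

end Translate

/-! ## §3 The superposition of two free runs: mild identity up to the cross Duhamel term -/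

section Superposed

variable {T M₁ M₂ : ℝ} {v₁ v₂ : ℝ → EuclideanSpace ℝ (Fin 3) → EuclideanSpace ℝ (Fin 3)}
  {q₁ q₂ : ℝ → EuclideanSpace ℝ (Fin 3) → ℝ}

/-- Joint measurability of a classical velocity on the open slab. [folklore] -/
theorem aestronglyMeasurable_of_classical {f v : ℝ → EuclideanSpace ℝ (Fin 3) → EuclideanSpace ℝ (Fin 3)}
    {q : ℝ → EuclideanSpace ℝ (Fin 3) → ℝ} (h : IsClassicalNSSolutionOn (Icc 0 T) 1 f v q) :
    AEStronglyMeasurable (uncurry v)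
      ((volume : Measure (ℝ × EuclideanSpace ℝ (Fin 3))).restrict (Ioo 0 T ×ˢ univ)) :=
  (h.smooth_velocity.continuousOn.mono (prod_mono Ioo_subset_Icc_self Subset.rfl)).aestronglyMeasurable
    (measurableSet_Ioo.prod MeasurableSet.univ)

/-- The heat Duhamel integral of the zero force vanishes (`ν = 1`). [folklore] -/
theorem forceDuhamel_zero_one (t : ℝ) (x : EuclideanSpace ℝ (Fin 3)) :
    forceDuhamel 1 0 (0 : ℝ → EuclideanSpace ℝ (Fin 3) → EuclideanSpace ℝ (Fin 3)) t x = 0 := by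
  rw [forceDuhamel_apply]
  have hz : ∀ τ, UnboundedOperators.heatExtension
      ((0 : ℝ → EuclideanSpace ℝ (Fin 3) → EuclideanSpace ℝ (Fin 3)) τ) (1 * (t - τ)) x = 0 := by
    intro τ
    have : ((0 : ℝ → EuclideanSpace ℝ (Fin 3) → EuclideanSpace ℝ (Fin 3)) τ) =
        fun _ : EuclideanSpace ℝ (Fin 3) => (0 : EuclideanSpace ℝ (Fin 3)) := rfl
    rw [this, UnboundedOperators.heatExtension_zero_fun]; rfl
  simp_rw [hz, integral_zero]

/-- The Oseen representation of a FREE classical bounded finite-energy run (`ν = 1`):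
`v(t) = e^{tΔ}v(0) − B¹_0(v, v)(t)` a.e., `t ∈ (0, T]`. [cite: LemarieRieusset2016, Thm. 6.1 (6.12) with Prop. 6.5] -/
theorem ae_eq_oseenMild_free {v : ℝ → EuclideanSpace ℝ (Fin 3) → EuclideanSpace ℝ (Fin 3)}
    {q : ℝ → EuclideanSpace ℝ (Fin 3) → ℝ} {M : ℝ}
    (h : IsClassicalNSSolutionOn (Icc 0 T) 1 0 v q) (hT : 0 < T)
    (hE : ∃ C : ℝ≥0∞, C < ⊤ ∧ ∀ t ∈ Icc 0 T, ∫⁻ x, ‖v t x‖ₑ ^ 2 ≤ C)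
    (hM : 0 < M) (hbd : ∀ t ∈ Icc 0 T, ∀ y, ‖v t y‖ ≤ M) {t : ℝ} (ht : t ∈ Ioc 0 T) :
    v t =ᵐ[volume] fun x => UnboundedOperators.heatExtension (v 0) (1 * t) x - oseenDuhamel 1 0 v v t x := by
  have hgc : Continuous (uncurry (0 : ℝ → EuclideanSpace ℝ (Fin 3) → EuclideanSpace ℝ (Fin 3))) :=
    continuous_const
  have hG : ∀ τ ∈ Icc 0 T, ∀ y,
      ‖(0 : ℝ → EuclideanSpace ℝ (Fin 3) → EuclideanSpace ℝ (Fin 3)) τ y‖ ≤ 0 := fun τ _ y => by simp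
  have hgdiv : ∀ τ ∈ Icc 0 T,
      IsWeaklyDivFree ((0 : ℝ → EuclideanSpace ℝ (Fin 3) → EuclideanSpace ℝ (Fin 3)) τ) :=
    fun τ _ θ _ => by simp
  have hg2 : ∀ τ ∈ Icc 0 T,
      eLpNorm ((0 : ℝ → EuclideanSpace ℝ (Fin 3) → EuclideanSpace ℝ (Fin 3)) τ) 2 volume ≤ (0 : ℝ≥0∞) :=
    fun τ _ => by simp
  have hrep := h.ae_eq_forced_oseenMild one_pos hT hgc hG hgdiv ENNReal.zero_ne_top hg2 hE hM hbd ht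
  filter_upwards [hrep] with x hx
  rw [hx, forceDuhamel_zero_one, add_zero]

variable (hT : 0 < T)
  (h₁ : IsClassicalNSSolutionOn (Icc 0 T) 1 0 v₁ q₁)
  (hE₁ : ∃ C : ℝ≥0∞, C < ⊤ ∧ ∀ t ∈ Icc 0 T, ∫⁻ x, ‖v₁ t x‖ₑ ^ 2 ≤ C)
  (hM₁ : 0 < M₁) (hbd₁ : ∀ t ∈ Icc 0 T, ∀ y, ‖v₁ t y‖ ≤ M₁)
  (h₂ : IsClassicalNSSolutionOn (Icc 0 T) 1 0 v₂ q₂)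
  (hE₂ : ∃ C : ℝ≥0∞, C < ⊤ ∧ ∀ t ∈ Icc 0 T, ∫⁻ x, ‖v₂ t x‖ₑ ^ 2 ≤ C)
  (hM₂ : 0 < M₂) (hbd₂ : ∀ t ∈ Icc 0 T, ∀ y, ‖v₂ t y‖ ≤ M₂)
  (c : EuclideanSpace ℝ (Fin 3))

include hT h₁ hE₁ hM₁ hbd₁ h₂ hE₂ hM₂ hbd₂

/-- **The superposition solves the Oseen integral equation up to the cross Duhamel term.** For free
classical bounded finite-energy runs `v₁, v₂` on `[0, T] × ℝ³` (`ν = 1`) and `c ∈ ℝ³`, the field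
`ṽ(t, x) = v₁(t, x) + v₂(t, x − c)` satisfies, for `t ∈ (0, T]`, a.e. in `x`,
`ṽ(t) = e^{tΔ} ṽ(0) − B¹_0(ṽ, ṽ)(t) + Φ_c(t)`, `Φ_c := B(ṽ, ṽ) − B(v₁, v₁) − B(v₂c, v₂c)`.
[cite: LemarieRieusset2016, Thm. 6.1 (6.12) with Prop. 6.5] -/
theorem superposed_oseenMild {t : ℝ} (ht : t ∈ Ioc 0 T) :
    (fun x => v₁ t x + v₂ t (x - c)) =ᵐ[volume] fun x =>
      UnboundedOperators.heatExtension ((fun t x => v₁ t x + v₂ t (x - c)) 0) (1 * t) x -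
        oseenDuhamel 1 0 (fun t x => v₁ t x + v₂ t (x - c)) (fun t x => v₁ t x + v₂ t (x - c)) t x +
      (oseenDuhamel 1 0 (fun t x => v₁ t x + v₂ t (x - c)) (fun t x => v₁ t x + v₂ t (x - c)) t x -
        oseenDuhamel 1 0 v₁ v₁ t x -
        oseenDuhamel 1 0 (fun t x => v₂ t (x - c)) (fun t x => v₂ t (x - c)) t x) := by
  have h₂c := translate h₂ c
  have hE₂c := energy_translate hE₂ c
  have hbd₂c : ∀ t ∈ Icc 0 T, ∀ y, ‖v₂ t (y - c)‖ ≤ M₂ := fun t ht y => hbd₂ t ht (y - c)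
  have hrep₁ := ae_eq_oseenMild_free h₁ hT hE₁ hM₁ hbd₁ ht
  have hrep₂ := ae_eq_oseenMild_free h₂c hT hE₂c hM₂ hbd₂c ht
  have h0I : (0 : ℝ) ∈ Icc 0 T := ⟨le_rfl, hT.le⟩
  have hνt : 0 < 1 * t := by rw [one_mul]; exact ht.1
  have hc₁ : Continuous (v₁ 0) := (h₁.contDiff_velocity h0I).continuous
  have hc₂ : Continuous (fun y => v₂ 0 (y - c)) := (h₂c.contDiff_velocity h0I).continuous
  have hheat : ∀ x, UnboundedOperators.heatExtension (fun y => v₁ 0 y + v₂ 0 (y - c)) (1 * t) x =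
      UnboundedOperators.heatExtension (v₁ 0) (1 * t) x +
        UnboundedOperators.heatExtension (fun y => v₂ 0 (y - c)) (1 * t) x := fun x =>
    UnboundedOperators.heatExtension_add_of_bound hc₁ hc₂ (hbd₁ 0 h0I) (fun z => hbd₂c 0 h0I z) hνt x
  filter_upwards [hrep₁, hrep₂] with x hx₁ hx₂
  beta_reduce at hx₁ hx₂ ⊢
  rw [hheat x, hx₁, hx₂]
  abel


omit hT hE₁ hM₁ hE₂ hM₂ in
/-- **The cross Duhamel term.** For `t ∈ (0, T]` and every `x`,
`Φ_c(t, x) = B(v₁, v₂c)(t)(x) + B(v₂c, v₁)(t)(x)` (`v₂c = v₂(·, · − c)`): bilinearity of the Oseen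
Duhamel form on bounded slab fields. [cite: KochNadirashviliSereginSverak2009, §4 p. 8 (arXiv:0709.3599v1)] -/
theorem superposedRemainder_eq {t : ℝ} (ht : t ∈ Ioc 0 T) (x : EuclideanSpace ℝ (Fin 3)) :
    oseenDuhamel 1 0 (fun t x => v₁ t x + v₂ t (x - c)) (fun t x => v₁ t x + v₂ t (x - c)) t x -
        oseenDuhamel 1 0 v₁ v₁ t x -
        oseenDuhamel 1 0 (fun t x => v₂ t (x - c)) (fun t x => v₂ t (x - c)) t x =
      oseenDuhamel 1 0 v₁ (fun t x => v₂ t (x - c)) t x +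
        oseenDuhamel 1 0 (fun t x => v₂ t (x - c)) v₁ t x := by
  have hν : (0 : ℝ) < 1 := one_pos
  have h₂c := translate h₂ c
  have hm₁ := aestronglyMeasurable_of_classical h₁
  have hm₂ := aestronglyMeasurable_of_classical h₂c
  have hsum_eq : uncurry (fun t x => v₁ t x + v₂ t (x - c)) =
      uncurry v₁ + uncurry (fun t x => v₂ t (x - c)) := by
    funext p; rfl
  have hms : AEStronglyMeasurable (uncurry fun t x => v₁ t x + v₂ t (x - c))
      ((volume : Measure (ℝ × EuclideanSpace ℝ (Fin 3))).restrict (Ioo 0 T ×ˢ univ)) := by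
    rw [hsum_eq]; exact hm₁.add hm₂
  have hb₁ : ∀ τ ∈ Ioo 0 T, ∀ y, ‖v₁ τ y‖ ≤ M₁ := fun τ hτ => hbd₁ τ ⟨hτ.1.le, hτ.2.le⟩
  have hb₂ : ∀ τ ∈ Ioo 0 T, ∀ y, ‖v₂ τ (y - c)‖ ≤ M₂ := fun τ hτ y => hbd₂ τ ⟨hτ.1.le, hτ.2.le⟩ (y - c)
  have hbs : ∀ τ ∈ Ioo 0 T, ∀ y, ‖v₁ τ y + v₂ τ (y - c)‖ ≤ M₁ + M₂ := fun τ hτ y =>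
    (norm_add_le _ _).trans (add_le_add (hb₁ τ hτ y) (hb₂ τ hτ y))
  -- `B(ṽ, ṽ) − B(v₁, ṽ) = B(v₂c, ṽ)`
  have E1 := oseenDuhamel_sub_left hν hms hm₁ hms hbs hb₁ hbs ht.1 ht.2 x
  have hf1 : (fun τ y => (v₁ τ y + v₂ τ (y - c)) - v₁ τ y) = fun τ y => v₂ τ (y - c) := by
    funext τ y; abel
  rw [hf1] at E1
  -- `B(v₁, ṽ) − B(v₁, v₁) = B(v₁, v₂c)`
  have E2 := oseenDuhamel_sub_right hν hm₁ hms hm₁ hb₁ hbs hb₁ ht.1 ht.2 x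
  rw [hf1] at E2
  -- `B(v₂c, ṽ) − B(v₂c, v₂c) = B(v₂c, v₁)`
  have E3 := oseenDuhamel_sub_right hν hm₂ hms hm₂ hb₂ hbs hb₂ ht.1 ht.2 x
  have hf2 : (fun τ y => (v₁ τ y + v₂ τ (y - c)) - v₂ τ (y - c)) = v₁ := by
    funext τ y; abel
  rw [hf2] at E3
  rw [E2, E3, E1]
  abel

omit hT h₁ hE₁ hM₁ h₂ hE₂ hM₂ in
/-- **The superposition is bounded by the larger bound plus the other run's tail**: if `v₁`, `v₂` are
`η₁`-, `η₂`-small off the ball `‖y‖ < ρ` and `‖c‖ ≥ 2ρ`, then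
`‖v₁(t, x) + v₂(t, x − c)‖ ≤ max (M₁ + η₂) (η₁ + M₂)` (at each point one of the two runs is far from its
own datum). [folklore] -/
theorem norm_superposed_le {ρ η₁ η₂ : ℝ}
    (htail₁ : ∀ t ∈ Icc 0 T, ∀ y, ρ ≤ ‖y‖ → ‖v₁ t y‖ ≤ η₁)
    (htail₂ : ∀ t ∈ Icc 0 T, ∀ y, ρ ≤ ‖y‖ → ‖v₂ t y‖ ≤ η₂) (hc : 2 * ρ ≤ ‖c‖)
    {t : ℝ} (ht : t ∈ Icc 0 T) (x : EuclideanSpace ℝ (Fin 3)) :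
    ‖v₁ t x + v₂ t (x - c)‖ ≤ max (M₁ + η₂) (η₁ + M₂) := by
  refine (norm_add_le _ _).trans ?_
  by_cases hx : ρ ≤ ‖x‖
  · exact (add_le_add (htail₁ t ht x hx) (hbd₂ t ht (x - c))).trans (le_max_right _ _)
  · have hxc : ρ ≤ ‖x - c‖ := by
      have h1 : ‖c‖ ≤ ‖c - x‖ + ‖x‖ := norm_le_norm_sub_add c x
      rw [norm_sub_rev] at h1
      linarith [not_le.1 hx]
    exact (add_le_add (hbd₁ t ht x) (htail₂ t ht (x - c) hxc)).trans (le_max_left _ _)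

omit hT hE₁ hE₂ in
/-- **The cross Duhamel term is small when the two runs sit far apart.** If `v₁`, `v₂` are `η₁`-,
`η₂`-small off the ball `‖y‖ < ρ` (uniformly in `t ∈ [0, T]`) and `‖c‖ ≥ 2ρ`, then for `t ∈ (0, T]` and
all `x`, `‖Φ_c(t, x)‖ ≤ 2 · C₀ (η₁ M₂ + M₁ η₂) · 2√T`. [cite: KochNadirashviliSereginSverak2009, §4 p. 8 (arXiv:0709.3599v1)] -/
theorem norm_superposedRemainder_le {ρ η₁ η₂ : ℝ} (hη₁ : 0 ≤ η₁) (hη₂ : 0 ≤ η₂)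
    (htail₁ : ∀ t ∈ Icc 0 T, ∀ y, ρ ≤ ‖y‖ → ‖v₁ t y‖ ≤ η₁)
    (htail₂ : ∀ t ∈ Icc 0 T, ∀ y, ρ ≤ ‖y‖ → ‖v₂ t y‖ ≤ η₂) (hc : 2 * ρ ≤ ‖c‖)
    {t : ℝ} (ht : t ∈ Ioc 0 T) (x : EuclideanSpace ℝ (Fin 3)) :
    ‖oseenDuhamel 1 0 (fun t x => v₁ t x + v₂ t (x - c)) (fun t x => v₁ t x + v₂ t (x - c)) t x -
        oseenDuhamel 1 0 v₁ v₁ t x -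
        oseenDuhamel 1 0 (fun t x => v₂ t (x - c)) (fun t x => v₂ t (x - c)) t x‖ ≤
      2 * (oseenSliceConst (EuclideanSpace ℝ (Fin 3)) * (η₁ * M₂ + M₁ * η₂) * (2 * Real.sqrt T)) := by
  rw [superposedRemainder_eq h₁ hbd₁ h₂ hbd₂ c ht x]
  have h₂c := translate h₂ c
  have hm₁ := aestronglyMeasurable_of_classical h₁
  have hm₂ := aestronglyMeasurable_of_classical h₂c
  have hb₁ : ∀ τ ∈ Ioo 0 T, ∀ y, ‖v₁ τ y‖ ≤ M₁ := fun τ hτ => hbd₁ τ ⟨hτ.1.le, hτ.2.le⟩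
  have hb₂ : ∀ τ ∈ Ioo 0 T, ∀ y, ‖v₂ τ (y - c)‖ ≤ M₂ := fun τ hτ y => hbd₂ τ ⟨hτ.1.le, hτ.2.le⟩ (y - c)
  -- off the ball `‖y‖ < ρ` the translate `v₂(· − c)` is ... ; inside it, `‖y − c‖ ≥ ρ`
  have hfar : ∀ y : EuclideanSpace ℝ (Fin 3), ¬ ρ ≤ ‖y‖ → ρ ≤ ‖y - c‖ := by
    intro y hy
    have h1 : ‖c‖ ≤ ‖c - y‖ + ‖y‖ := norm_le_norm_sub_add c y
    rw [norm_sub_rev] at h1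
    linarith [not_le.1 hy]
  have hS : MeasurableSet {y : EuclideanSpace ℝ (Fin 3) | ρ ≤ ‖y‖} :=
    (isClosed_le continuous_const continuous_norm).measurableSet
  have hSc : MeasurableSet {y : EuclideanSpace ℝ (Fin 3) | ρ ≤ ‖y‖}ᶜ := hS.compl
  have hsqrt : Real.sqrt t ≤ Real.sqrt T := Real.sqrt_le_sqrt ht.2
  have hC₀ := (oseenSliceConst_pos (E := EuclideanSpace ℝ (Fin 3))).le
  have hMM₁ : 0 ≤ M₁ := hM₁.le
  have hMM₂ : 0 ≤ M₂ := hM₂.le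
  -- `B(v₁, v₂c)`: `v₁` small on `S = {ρ ≤ ‖y‖}`, `v₂c` small off `S`
  have hA := norm_oseenDuhamel_le_of_split (a := v₁) (b := fun τ y => v₂ τ (y - c)) hS hm₁ hm₂ hb₁ hb₂
    hη₁ hη₂ (fun τ hτ y hy => htail₁ τ ⟨hτ.1.le, hτ.2.le⟩ y hy)
    (fun τ hτ y hy => htail₂ τ ⟨hτ.1.le, hτ.2.le⟩ (y - c) (hfar y hy)) ht.1 ht.2 x
  -- `B(v₂c, v₁)`: `v₂c` small on `Sᶜ`, `v₁` small off `Sᶜ`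
  have hB := norm_oseenDuhamel_le_of_split (a := fun τ y => v₂ τ (y - c)) (b := v₁) hSc hm₂ hm₁ hb₂ hb₁
    hη₂ hη₁ (fun τ hτ y hy => htail₂ τ ⟨hτ.1.le, hτ.2.le⟩ (y - c) (hfar y hy))
    (fun τ hτ y hy => htail₁ τ ⟨hτ.1.le, hτ.2.le⟩ y (not_not.1 hy)) ht.1 ht.2 x
  calc ‖oseenDuhamel 1 0 v₁ (fun t x => v₂ t (x - c)) t x +
        oseenDuhamel 1 0 (fun t x => v₂ t (x - c)) v₁ t x‖
      ≤ ‖oseenDuhamel 1 0 v₁ (fun t x => v₂ t (x - c)) t x‖ +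
        ‖oseenDuhamel 1 0 (fun t x => v₂ t (x - c)) v₁ t x‖ := norm_add_le _ _
    _ ≤ oseenSliceConst (EuclideanSpace ℝ (Fin 3)) * (η₁ * M₂ + M₁ * η₂) * (2 * Real.sqrt t) +
        oseenSliceConst (EuclideanSpace ℝ (Fin 3)) * (η₂ * M₁ + M₂ * η₁) * (2 * Real.sqrt t) :=
        add_le_add hA hB
    _ = 2 * (oseenSliceConst (EuclideanSpace ℝ (Fin 3)) * (η₁ * M₂ + M₁ * η₂) * (2 * Real.sqrt t)) := by
        ring
    _ ≤ 2 * (oseenSliceConst (EuclideanSpace ℝ (Fin 3)) * (η₁ * M₂ + M₁ * η₂) * (2 * Real.sqrt T)) := by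
        gcongr

end Superposed

end Summit.NavierStokesRegularity.FluidComputer.PalasekTowerClayBridge.SuperposedRun

end
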